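import Summits.KontsevichZagierPeriods.KontsevichZagierPeriods.Theorems.HyperbolicBlochOffTetraSectorKernelSplit

/-!
# `OffTetraSectorKernelPiSplitGlue` (stmt-KontsevichZagierPeriods-18247): the `[π]`-split of the crux
# `OffTetraSectorKernel` glues

Route HyperbolicBloch, support item 18247 — the GLUE implication of the crux-strategist's split of the
crux `OffTetraSectorKernel` (stmt-10557) along the disc `[π]` (Kontsevich–Zagier, *Periods* (2001),
§4.1, `P̂ = P[(2πi)⁻¹]` read in both directions; Ayoub 2014, Def. 6 / Conj. 7):

  ⟨body of `AyoubPiLocalKernel` (stmt-0541)⟩ → ⟨body of `AyoubPiCancellation` (stmt-0540)⟩ →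
    `OffTetraSectorKernel`.

The work is `PiSplit.offTetraSectorKernel_of_subs`
(`Theorems/HyperbolicBlochOffTetraSectorKernelSplit.lean`): the pinned family `P n r = [unit disc] × r`
exists (`BetaCancellationLine.exists_pinned`), child 1 gives `(lift (of ∘ P))^[N] c ∈ KZ.relations`
for every `c` of value `0`, child 2 peels the `N` factors one at a time, and the kernel form lands in
the left summand of `KZ.relations ⊔ closure (tetrahedral value-relators)`. This file only restates
that theorem at the item's own name (pattern of `LiouvilleUnfoldingLogKernelConjectureSplitGlue`).
Unconditional; nothing here asserts either child.

References: M. Kontsevich, D. Zagier, *Periods* (2001), §1.2 Conjecture 1, §4.1; J. Ayoub, *Periods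
and the conjectures of Grothendieck and Kontsevich–Zagier*, EMS Newsl. 91 (2014), Def. 6 / Conj. 7;
A. Huber, G. Wüstholz, *Transcendence and linear relations of 1-periods* (2022), App. A.3–A.4.
-/

noncomputable section

namespace Summit.KontsevichZagierPeriods.HyperbolicBloch.OffTetraSectorKernel.PiSplit

/-- **Item stmt-KontsevichZagierPeriods-18247, as filed.** The glue of the split of the crux
`OffTetraSectorKernel` along `[π]`, by the literal statements of the children (`AyoubPiLocalKernel`,
stmt-0541, then `AyoubPiCancellation`, stmt-0540): `Sub₁ → Sub₂ → OffTetraSectorKernel`.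
Unconditional: it is `PiSplit.offTetraSectorKernel_of_subs` on the nose.
[cite: KontsevichZagier2001, §4.1] -/
theorem offTetraSectorKernelPiSplitGlue_proof :
    Summit.KontsevichZagierPeriods.KontsevichZagierPeriods.Theses.HyperbolicBloch.OffTetraSectorKernelPiSplitGlue := by
  unfold Summit.KontsevichZagierPeriods.KontsevichZagierPeriods.Theses.HyperbolicBloch.OffTetraSectorKernelPiSplitGlue
  exact offTetraSectorKernel_of_subs

end Summit.KontsevichZagierPeriods.HyperbolicBloch.OffTetraSectorKernel.PiSplit

end
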